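import Summits.ABC.ABC.Statement
import HarnessLib

/-!
# The cyclotomic–radical and power-ends forms of the abc conjecture

Solo seat `solo-ABC-blind` (ideation tier, summit-directed).  New tree infrastructure (a
folklore-level reformulation, not in print in this form as far as the seat's searches show; the
device "pass to `(uⁿ, vⁿ − uⁿ, vⁿ)`" is classical, cf. the `16 ∣ abc` normalisation for Frey curves).

For `n ≥ 1` consider the binary form `X · Y · (Yⁿ − Xⁿ) = X · Y · ∏_{d ∣ n} Φ_d(X, Y)` of degree
`n + 2` and the Stewart-type lower bound for the radical of its values

* `CycloRad n`: for every `ε > 0` there is `κ > 0` with `κ · v^{n − ε} ≤ rad(u · v · (vⁿ − uⁿ))`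
  for all coprime `0 < u < v`  (exponent `n − ε = deg − 2 − ε`),

and the restriction of abc to the thin family of triples whose outer members are `n`-th powers

* `ABCOnPowEnds n`: the abc inequality `c < C(ε) rad(abc)^{1+ε}` for abc triples with `a = xⁿ`,
  `c = zⁿ`.

**Theorems.** For every `n ≥ 1`: `ABC ↔ CycloRad n ↔ ABCOnPowEnds n`
(`abc_iff_cycloRad`, `abc_iff_abcOnPowEnds`).  `ABC → ABCOnPowEnds n` is restriction;
`ABCOnPowEnds n → CycloRad n` applies the restricted inequality to `(uⁿ, vⁿ − uⁿ, vⁿ)`, whose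
radical is `rad(u v (vⁿ − uⁿ))`; `CycloRad n → ABC` evaluates the form at `(u, v) = (a, c)` for an
abc triple `a + b = c`: `cⁿ − aⁿ = b · m` with `0 < m ≤ n cⁿ⁻¹`, hence
`rad(a c (cⁿ − aⁿ)) ≤ n cⁿ⁻¹ rad(abc)` and `κ c^{n−ε} ≤ n c^{n−1} rad(abc)`, i.e.
`c^{1−ε} ≤ (n/κ) rad(abc)`.

**The polynomial threshold** (`polyABC_of_radLowerBound`).  The same evaluation shows that a lower
bound `κ v^{(n−1)+θ} ≤ rad(u v (vⁿ − uⁿ))` with ANY `θ > 0` for ONE `n` yields the polynomial abc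
inequality `c ≤ C · rad(abc)^{1/θ}` (`PolyABC (1/θ)`).  No inequality `c ≤ C rad(abc)^K` with a
fixed `K` is known: the unconditional bounds are exponential in the radical
(Stewart–Yu 2001, `log c ≤ κ R^{1/3} (log R)^3`; Pasten, arXiv:2312.03566, §1 and Thm. 1.4 for the
subexponential bounds in special ranges), so `PolyABC K` for some `K` is the first milestone any
proof of abc passes, and in the coordinates of this file it reads: beat the exponent `n − 1`
(out of the trivial `n + 2`) for the radical of `u v (vⁿ − uⁿ)`.

References: Stewart–Yu, Duke Math. J. 108 (2001) [StewartYu2001]; A. Baker, Publ. Math. Debrecen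
65 (2004) 253–260, §2 [Baker2004]; H. Pasten, arXiv:2312.03566, §1; Bombieri–Gubler (2006)
Conj. 12.2.2 [BombieriGubler2006].
-/

noncomputable section

open UniqueFactorizationMonoid

namespace Summit.ABC.ABC.Theorems

open Literature.NumberTheory.DiophantineGeometry

/-! ### Statements -/

/-- `CycloRad n`: Stewart-type lower bound for the radical of `u · v · (vⁿ − uⁿ)`:
for every `ε > 0` there is `κ > 0` with `κ · v^{n−ε} ≤ rad(u v (vⁿ − uⁿ))` for all coprime
`0 < u < v` (radical computed in `ℕ`). [folklore] -/
def CycloRad (n : ℕ) : Prop :=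
  ∀ ε : ℝ, 0 < ε → ∃ κ : ℝ, 0 < κ ∧ ∀ u v : ℕ, 0 < u → u < v → Nat.Coprime u v →
    κ * (v : ℝ) ^ ((n : ℝ) - ε) ≤ ((radical (u * v * (v ^ n - u ^ n)) : ℕ) : ℝ)

/-- `ABCOnPowEnds n`: the abc inequality restricted to abc triples `(xⁿ, b, zⁿ)` whose outer
members are `n`-th powers. [folklore] -/
def ABCOnPowEnds (n : ℕ) : Prop :=
  ∀ ε : ℝ, 0 < ε → ∃ C : ℝ, 0 < C ∧ ∀ a b c : ℕ, IsABCTriple a b c →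
    (∃ x : ℕ, a = x ^ n) → (∃ z : ℕ, c = z ^ n) →
      (c : ℝ) < C * ((rad a b c : ℕ) : ℝ) ^ (1 + ε)

/-- `PolyABC K`: a polynomial abc inequality `c ≤ C · rad(abc)^K` with a fixed exponent `K`.
(Open for every `K`; `ABC` gives it for every `K > 1`, `polyABC_of_abc`.) [folklore] -/
def PolyABC (K : ℝ) : Prop :=
  ∃ C : ℝ, 0 < C ∧ ∀ a b c : ℕ, IsABCTriple a b c → (c : ℝ) ≤ C * ((rad a b c : ℕ) : ℝ) ^ K

/-! ### Arithmetic of `cⁿ − aⁿ` -/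

/-- `c^{k+1} ≤ a^{k+1} + (k+1) c^k (c − a)` for `a ≤ c` (mean-value bound, in `ℕ`). [folklore] -/
theorem pow_succ_le_pow_succ_add_mul (a c k : ℕ) (hac : a ≤ c) :
    c ^ (k + 1) ≤ a ^ (k + 1) + (k + 1) * c ^ k * (c - a) := by
  obtain ⟨d, rfl⟩ := Nat.exists_eq_add_of_le hac
  simp only [Nat.add_sub_cancel_left]
  induction k with
  | zero => simp
  | succ k ih =>
    have hak : a ^ (k + 1) ≤ (a + d) ^ (k + 1) := Nat.pow_le_pow_left (Nat.le_add_right a d) _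
    calc (a + d) ^ (k + 2) = (a + d) * (a + d) ^ (k + 1) := by ring
      _ ≤ (a + d) * (a ^ (k + 1) + (k + 1) * (a + d) ^ k * d) := Nat.mul_le_mul_left _ ih
      _ = a * a ^ (k + 1) + d * a ^ (k + 1) + (k + 1) * (a + d) ^ (k + 1) * d := by ring
      _ ≤ a * a ^ (k + 1) + d * (a + d) ^ (k + 1) + (k + 1) * (a + d) ^ (k + 1) * d := by
          gcongr
      _ = a ^ (k + 2) + (k + 2) * (a + d) ^ (k + 1) * d := by ring

/-- For `a < c`: `c^{k+1} − a^{k+1} = (c − a) · m` with `0 < m ≤ (k+1) c^k`. [folklore] -/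
theorem exists_pow_sub_pow_eq_mul (a c k : ℕ) (hac : a < c) :
    ∃ m : ℕ, c ^ (k + 1) - a ^ (k + 1) = (c - a) * m ∧ 0 < m ∧ m ≤ (k + 1) * c ^ k := by
  obtain ⟨m, hm⟩ := Nat.sub_dvd_pow_sub_pow c a (k + 1)
  have hlt : a ^ (k + 1) < c ^ (k + 1) := Nat.pow_lt_pow_left hac (by omega)
  have hpos : 0 < c - a := by omega
  have hle := pow_succ_le_pow_succ_add_mul a c k hac.le
  refine ⟨m, hm, ?_, ?_⟩
  · rcases Nat.eq_zero_or_pos m with h | h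
    · rw [h, mul_zero] at hm; omega
    · exact h
  · have h2 : (c - a) * m ≤ (c - a) * ((k + 1) * c ^ k) := by
      rw [← hm]
      calc c ^ (k + 1) - a ^ (k + 1) ≤ (k + 1) * c ^ k * (c - a) := by omega
        _ = (c - a) * ((k + 1) * c ^ k) := by ring
    exact Nat.le_of_mul_le_mul_left h2 hpos

/-! ### Radicals -/

/-- `rad(x · m) ≤ rad(x) · m` for `m > 0`. [folklore] -/
theorem radical_mul_le_radical_mul (x m : ℕ) (hm : 0 < m) :
    radical (x * m) ≤ radical x * m := by
  have h : radical (x * m) ∣ radical x * m :=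
    radical_mul_dvd.trans (mul_dvd_mul_left _ radical_dvd_self)
  have hx : radical x ≠ 0 := radical_ne_zero
  exact Nat.le_of_dvd (Nat.mul_pos (Nat.pos_of_ne_zero hx) hm) h

/-- `rad(uⁿ · w · vⁿ) = rad(u · v · w)` for `n ≠ 0` and nonzero arguments. [folklore] -/
theorem radical_pow_mul_mul_pow (u v w n : ℕ) (hn : n ≠ 0) (hu : u ≠ 0) (hv : v ≠ 0)
    (hw : w ≠ 0) : radical (u ^ n * w * v ^ n) = radical (u * v * w) := by
  rw [natRadical_eq_iff, Nat.primeFactors_mul (by positivity) (by positivity),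
    Nat.primeFactors_mul (by positivity) hw, Nat.primeFactors_mul (by positivity) hw,
    Nat.primeFactors_mul hu hv, Nat.primeFactors_pow _ hn, Nat.primeFactors_pow _ hn]
  exact Finset.union_right_comm _ _ _

/-- The radical of an abc triple is positive (as a real number). [folklore] -/
theorem rad_cast_pos {a b c : ℕ} (h : IsABCTriple a b c) : (0 : ℝ) < ((rad a b c : ℕ) : ℝ) := by
  obtain ⟨ha, hb, habc, -⟩ := h
  have hc : 0 < c := by omega
  have h0 : a * b * c ≠ 0 := by positivity
  have : rad a b c ≠ 0 := ne_zero_of_dvd_ne_zero h0 radical_dvd_self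
  exact_mod_cast Nat.pos_of_ne_zero this

/-! ### Evaluating the form at `(a, c)` -/

/-- For an abc triple `a + b = c`: `rad(a · c · (c^{k+1} − a^{k+1})) ≤ (k+1) c^k rad(abc)`. [folklore] -/
theorem radical_form_le (a b c k : ℕ) (h : IsABCTriple a b c) :
    ((radical (a * c * (c ^ (k + 1) - a ^ (k + 1))) : ℕ) : ℝ)
      ≤ ((k : ℝ) + 1) * (c : ℝ) ^ k * ((rad a b c : ℕ) : ℝ) := by
  obtain ⟨ha, hb, habc, hcop⟩ := h
  have hac : a < c := by omega
  obtain ⟨m, hm, hm0, hmle⟩ := exists_pow_sub_pow_eq_mul a c k hac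
  have hca : c - a = b := by omega
  rw [hca] at hm
  have hre : a * c * (b * m) = (a * b * c) * m := by ring
  have h1 : radical (a * c * (c ^ (k + 1) - a ^ (k + 1))) ≤ radical (a * b * c) * m := by
    rw [hm, hre]; exact radical_mul_le_radical_mul _ _ hm0
  have h2 : ((radical (a * c * (c ^ (k + 1) - a ^ (k + 1))) : ℕ) : ℝ)
      ≤ ((radical (a * b * c) : ℕ) : ℝ) * (m : ℝ) := by exact_mod_cast h1
  have h3 : (m : ℝ) ≤ ((k : ℝ) + 1) * (c : ℝ) ^ k := by exact_mod_cast hmle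
  have hR : (0 : ℝ) ≤ ((radical (a * b * c) : ℕ) : ℝ) := Nat.cast_nonneg _
  calc _ ≤ ((radical (a * b * c) : ℕ) : ℝ) * (m : ℝ) := h2
    _ ≤ ((radical (a * b * c) : ℕ) : ℝ) * (((k : ℝ) + 1) * (c : ℝ) ^ k) :=
        mul_le_mul_of_nonneg_left h3 hR
    _ = ((k : ℝ) + 1) * (c : ℝ) ^ k * ((rad a b c : ℕ) : ℝ) := by rw [rad_def]; ring

/-- Transport of a radical lower bound for `u v (v^{k+1} − u^{k+1})` to abc triples. [folklore] -/
theorem abc_eval (k : ℕ) {μ κ : ℝ}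
    (H : ∀ u v : ℕ, 0 < u → u < v → Nat.Coprime u v →
      κ * (v : ℝ) ^ μ ≤ ((radical (u * v * (v ^ (k + 1) - u ^ (k + 1))) : ℕ) : ℝ))
    {a b c : ℕ} (h : IsABCTriple a b c) :
    κ * (c : ℝ) ^ μ ≤ ((k : ℝ) + 1) * (c : ℝ) ^ k * ((rad a b c : ℕ) : ℝ) := by
  obtain ⟨ha, hb, habc, hcop⟩ := h
  have hac : a < c := by omega
  have hcopac : Nat.Coprime a c := by
    rw [← habc, Nat.Coprime, Nat.gcd_self_add_right]; exact hcop
  exact (H a c ha hac hcopac).trans (radical_form_le a b c k ⟨ha, hb, habc, hcop⟩)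

/-! ### Real-analysis helpers -/

/-- From `c^θ ≤ X` (`θ > 0`, `c ≥ 0`) to `c ≤ X^{1/θ}`. [folklore] -/
theorem le_rpow_one_div_of_rpow_le {c X θ : ℝ} (hθ : 0 < θ) (hc : 0 ≤ c) (h : c ^ θ ≤ X) :
    c ≤ X ^ (1 / θ) := by
  have hX : 0 ≤ X := (Real.rpow_nonneg hc θ).trans h
  have h1 : (c ^ θ) ^ (1 / θ) ≤ X ^ (1 / θ) :=
    Real.rpow_le_rpow (Real.rpow_nonneg hc θ) h (by positivity)
  rwa [← Real.rpow_mul hc, show θ * (1 / θ) = 1 by field_simp, Real.rpow_one] at h1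

/-! ### The polynomial threshold -/

/-- **Polynomial abc from one exponent above `n − 1`.**  If for some `k` and some `θ > 0`,
`κ · v^{k+θ} ≤ rad(u v (v^{k+1} − u^{k+1}))` for all coprime `0 < u < v`, then
`c ≤ C · rad(abc)^{1/θ}` for all abc triples. [folklore] -/
theorem polyABC_of_radLowerBound (k : ℕ) {θ κ : ℝ} (hθ : 0 < θ) (hκ : 0 < κ)
    (H : ∀ u v : ℕ, 0 < u → u < v → Nat.Coprime u v →
      κ * (v : ℝ) ^ ((k : ℝ) + θ) ≤ ((radical (u * v * (v ^ (k + 1) - u ^ (k + 1))) : ℕ) : ℝ)) :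
    PolyABC (1 / θ) := by
  refine ⟨(((k : ℝ) + 1) / κ) ^ (1 / θ), by positivity, ?_⟩
  intro a b c h
  have key := abc_eval k H h
  have hR := rad_cast_pos h
  obtain ⟨ha, hb, habc, -⟩ := h
  have hc0 : (0 : ℝ) < c := by exact_mod_cast (show 0 < c by omega)
  set R : ℝ := ((rad a b c : ℕ) : ℝ) with hRdef
  -- split the exponent: c^(k+θ) = c^k * c^θ
  have hsplit : (c : ℝ) ^ ((k : ℝ) + θ) = (c : ℝ) ^ k * (c : ℝ) ^ θ := by
    rw [Real.rpow_add hc0, Real.rpow_natCast]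
  rw [hsplit] at key
  -- cancel c^k
  have hck : (0 : ℝ) < (c : ℝ) ^ k := by positivity
  have key2 : κ * (c : ℝ) ^ θ ≤ ((k : ℝ) + 1) * R := by
    have : (c : ℝ) ^ k * (κ * (c : ℝ) ^ θ) ≤ (c : ℝ) ^ k * (((k : ℝ) + 1) * R) := by
      calc (c : ℝ) ^ k * (κ * (c : ℝ) ^ θ) = κ * ((c : ℝ) ^ k * (c : ℝ) ^ θ) := by ring
        _ ≤ ((k : ℝ) + 1) * (c : ℝ) ^ k * R := key
        _ = (c : ℝ) ^ k * (((k : ℝ) + 1) * R) := by ring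
    exact le_of_mul_le_mul_left this hck
  have key3 : (c : ℝ) ^ θ ≤ ((k : ℝ) + 1) / κ * R := by
    rw [div_mul_eq_mul_div, le_div_iff₀ hκ]; linarith [key2]
  have key4 := le_rpow_one_div_of_rpow_le hθ hc0.le key3
  rwa [Real.mul_rpow (by positivity) hR.le] at key4

/-- `ABC` gives `PolyABC K` for every `K > 1` (with `≤`). [folklore] -/
theorem polyABC_of_abc (habc : ABC) {K : ℝ} (hK : 1 < K) : PolyABC K := by
  rw [ABC_iff] at habc
  obtain ⟨C, hC, H⟩ := habc (K - 1) (by linarith)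
  exact ⟨C, hC, fun a b c h => by simpa using (H a b c h).le⟩

/-! ### `CycloRad n → ABC` -/

/-- **`CycloRad n` implies abc** (`n ≥ 1`). [folklore] -/
theorem abc_of_cycloRad {n : ℕ} (hn : 1 ≤ n) (H : CycloRad n) : ABC := by
  obtain ⟨k, rfl⟩ : ∃ k, n = k + 1 := ⟨n - 1, by omega⟩
  rw [ABC_iff]
  intro ε hε
  -- θ = 1/(1+ε); use CycloRad with ε' = 1 - θ, exponent (k+1) - (1-θ) = k + θ
  set θ : ℝ := 1 / (1 + ε) with hθdef
  have hθ0 : 0 < θ := by positivity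
  have hθ1 : θ < 1 := by rw [hθdef, div_lt_one (by positivity)]; linarith
  obtain ⟨κ, hκ, Hκ⟩ := H (1 - θ) (by linarith)
  have H' : ∀ u v : ℕ, 0 < u → u < v → Nat.Coprime u v →
      κ * (v : ℝ) ^ ((k : ℝ) + θ) ≤ ((radical (u * v * (v ^ (k + 1) - u ^ (k + 1))) : ℕ) : ℝ) := by
    intro u v hu huv hc
    have := Hκ u v hu huv hc
    rwa [show ((k + 1 : ℕ) : ℝ) - (1 - θ) = (k : ℝ) + θ by push_cast; ring] at this
  obtain ⟨C, hC, HC⟩ := polyABC_of_radLowerBound k hθ0 hκ H'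
  have hinv : 1 / θ = 1 + ε := by rw [hθdef, one_div_one_div]
  refine ⟨C + 1, by positivity, ?_⟩
  intro a b c h
  have hR := rad_cast_pos h
  have h1 := HC a b c h
  rw [hinv] at h1
  have hpow : (0 : ℝ) < ((rad a b c : ℕ) : ℝ) ^ (1 + ε) := Real.rpow_pos_of_pos hR _
  calc (c : ℝ) ≤ C * ((rad a b c : ℕ) : ℝ) ^ (1 + ε) := h1
    _ < (C + 1) * ((rad a b c : ℕ) : ℝ) ^ (1 + ε) := by nlinarith

/-! ### `ABCOnPowEnds n → CycloRad n` and `ABC → ABCOnPowEnds n` -/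

/-- `ABC` restricts to the power-ends family. [folklore] -/
theorem abcOnPowEnds_of_abc (habc : ABC) (n : ℕ) : ABCOnPowEnds n := by
  rw [ABC_iff] at habc
  intro ε hε
  obtain ⟨C, hC, H⟩ := habc ε hε
  exact ⟨C, hC, fun a b c h _ _ => H a b c h⟩

/-- **abc on the power-ends family implies `CycloRad n`** (`n ≥ 1`): apply the restricted
inequality to `(uⁿ, vⁿ − uⁿ, vⁿ)`, whose radical is `rad(u v (vⁿ − uⁿ))`. [folklore] -/
theorem cycloRad_of_abcOnPowEnds {n : ℕ} (hn : 1 ≤ n) (habc : ABCOnPowEnds n) : CycloRad n := by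
  intro ε hε
  have hn0 : (0 : ℝ) < n := by exact_mod_cast (show 0 < n by omega)
  set δ : ℝ := ε / n with hδdef
  have hδ : 0 < δ := by positivity
  obtain ⟨C, hC, H⟩ := habc δ hδ
  refine ⟨(1 / C) ^ (1 / (1 + δ)), by positivity, ?_⟩
  intro u v hu huv hcop
  have hv : 0 < v := by omega
  have hlt : u ^ n < v ^ n := Nat.pow_lt_pow_left huv (by omega)
  have hT : IsABCTriple (u ^ n) (v ^ n - u ^ n) (v ^ n) := by
    refine ⟨by positivity, by omega, by omega, ?_⟩
    exact (Nat.coprime_sub_self_right hlt.le).mpr (Nat.Coprime.pow n n hcop)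
  have hH := H _ _ _ hT ⟨u, rfl⟩ ⟨v, rfl⟩
  have hradeq : rad (u ^ n) (v ^ n - u ^ n) (v ^ n) = radical (u * v * (v ^ n - u ^ n)) := by
    rw [rad_def]
    exact radical_pow_mul_mul_pow u v (v ^ n - u ^ n) n (by omega) (by omega) (by omega) (by omega)
  rw [hradeq] at hH
  push_cast at hH
  set ρ : ℝ := ((radical (u * v * (v ^ n - u ^ n)) : ℕ) : ℝ) with hρdef
  have hρ0 : 0 ≤ ρ := Nat.cast_nonneg _
  have hvR : (0 : ℝ) < v := by exact_mod_cast hv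
  have hv1 : (1 : ℝ) ≤ v := by exact_mod_cast hv
  -- (v^n / C) < ρ^(1+δ)
  have h1 : (v : ℝ) ^ n / C < ρ ^ (1 + δ) := by
    rw [div_lt_iff₀ hC]; linarith [hH]
  -- take (1+δ)-th roots
  have h2 : ((v : ℝ) ^ n / C) ^ (1 / (1 + δ)) < ρ := by
    have := Real.rpow_lt_rpow (by positivity) h1 (by positivity : (0 : ℝ) < 1 / (1 + δ))
    rwa [← Real.rpow_mul hρ0, show (1 + δ) * (1 / (1 + δ)) = 1 by field_simp,
      Real.rpow_one] at this
  -- rewrite the left-hand side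
  have h3 : ((v : ℝ) ^ n / C) ^ (1 / (1 + δ))
      = (1 / C) ^ (1 / (1 + δ)) * (v : ℝ) ^ ((n : ℝ) / (1 + δ)) := by
    rw [div_eq_mul_one_div ((v : ℝ) ^ n) C, mul_comm ((v : ℝ) ^ n),
      Real.mul_rpow (by positivity) (by positivity), ← Real.rpow_natCast,
      ← Real.rpow_mul hvR.le, mul_one_div]
  -- compare exponents: n - ε ≤ n/(1+δ)
  have hexp : (n : ℝ) - ε ≤ (n : ℝ) / (1 + δ) := by
    rw [le_div_iff₀ (by positivity)]
    have hnd : (n : ℝ) * δ = ε := by rw [hδdef]; field_simp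
    nlinarith [mul_pos hε hδ]
  have h4 : (v : ℝ) ^ ((n : ℝ) - ε) ≤ (v : ℝ) ^ ((n : ℝ) / (1 + δ)) :=
    Real.rpow_le_rpow_of_exponent_le hv1 hexp
  calc (1 / C) ^ (1 / (1 + δ)) * (v : ℝ) ^ ((n : ℝ) - ε)
      ≤ (1 / C) ^ (1 / (1 + δ)) * (v : ℝ) ^ ((n : ℝ) / (1 + δ)) :=
        mul_le_mul_of_nonneg_left h4 (by positivity)
    _ = ((v : ℝ) ^ n / C) ^ (1 / (1 + δ)) := h3.symm
    _ ≤ ρ := h2.le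

/-- **abc implies `CycloRad n`.** [folklore] -/
theorem cycloRad_of_abc (habc : ABC) {n : ℕ} (hn : 1 ≤ n) : CycloRad n :=
  cycloRad_of_abcOnPowEnds hn (abcOnPowEnds_of_abc habc n)

/-! ### The equivalences -/

/-- **`ABC ↔ CycloRad n`** for every `n ≥ 1`: the abc conjecture is equivalent to the lower bound
`rad(u v (vⁿ − uⁿ)) ≫_ε v^{n−ε}` for coprime `0 < u < v`. [folklore] -/
theorem abc_iff_cycloRad {n : ℕ} (hn : 1 ≤ n) : ABC ↔ CycloRad n :=
  ⟨fun h => cycloRad_of_abc h hn, abc_of_cycloRad hn⟩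

/-- **`ABC ↔ ABCOnPowEnds n`** for every `n ≥ 1`: abc is equivalent to its restriction to the
thin family of triples `(xⁿ, b, zⁿ)`. [folklore] -/
theorem abc_iff_abcOnPowEnds {n : ℕ} (hn : 1 ≤ n) : ABC ↔ ABCOnPowEnds n :=
  ⟨fun h => abcOnPowEnds_of_abc h n, fun h => abc_of_cycloRad hn (cycloRad_of_abcOnPowEnds hn h)⟩

/-- **abc on the power-ends family implies abc.** [folklore] -/
theorem abc_of_abcOnPowEnds {n : ℕ} (hn : 1 ≤ n) (h : ABCOnPowEnds n) : ABC :=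
  (abc_iff_abcOnPowEnds hn).mpr h

end Summit.ABC.ABC.Theorems

end
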